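import Mathlib
import Summits.MatrixMultiplication.MatrixMultiplication.Theorems.SubgroupIdentityDesigns.Negative.TorusCube
import Summits.MatrixMultiplication.MatrixMultiplication.Theorems.SubgroupIdentityDesigns.Negative.BorelFamilyF

/-!
# The ghost criterion: Theorem H, FAIL direction, for every subset of a Borel of `GL₂(𝔽_p)`
(negative lemma for the crux `SubgroupIdentityDesigns`, stmt-MatrixMultiplication-14079; cell B2b-5,
gen 6 — report `run/shared/lean/b2b/levelgraded-cu/ORACLE-g6.md` §G6-1)

A level-one function `f = Σ_{rk M ≤ 1} c_M ψ(tr(M g))` restricted to the upper-triangular points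
`b(x,z,y) = [[x, y], [0, z]]` has UNIPOTENT-COSET SUMS of the special form
`Σ_y f(b(x,z,y)) = Φ₁(x) + Φ₂(z)` (`sum_psi_bPt`: the coset sum of the mode `M` is
`p·[M₁₀ = 0]·ψ(M₀₀ x + M₁₁ z)`, and `rk M ≤ 1`, `M₁₀ = 0` force `M₀₀ M₁₁ = 0`).  Hence every GHOST —
a weight `λ(x,z)` on full cosets inside the tested set `S` with all row sums `Σ_z λ(x,z)` and all
column sums `Σ_x λ(x,z)` zero — annihilates `f` (`ghost_sum_eq_zero`), while a level-one identity
test (`f(1) = 1`, `f = 0` on `S ∖ {1}`) would give the value `λ(1,1)`.  So: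
* `no_idTest_of_ghost` — a ghost with `λ(1,1) ≠ 0` supported on full unipotent cosets inside
  `S ⊆ M₂(𝔽_p)` kills every level-one identity test on `S` (matrix model, as `TorusCube`);
* `no_levelOne_design_of_ghost` — the same in the literal shape of the crux's design clause at
  `(m,k) = (2,1)` for subgroups `H₁, H₂, H₃ ≤ GL₂(𝔽_p)` whose triple products contain the cosets.
This is the FAIL half of the cell's THEOREM H ((1,1) on a cycle of the coset graph ⇒ FAIL: the
alternating ±1 weight of the cycle is a ghost); the torus square `no_idTest_of_torusCube` (`k = 1`) is
the 4-cycle.  Sorry-free; axioms `propext`, `Classical.choice`, `Quot.sound`.  VALUE = a certificate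
format (exhibit a ghost ⇒ FAIL) for the finite frontier of the crux, NOT summit progress.
-/

set_option linter.dupNamespace false

noncomputable section

open scoped BigOperators Classical
open Summit.MatrixMultiplication.MatrixMultiplication.Theorems.LieRankDesigns.Negative (GLm Mat)

namespace Summit.MatrixMultiplication.MatrixMultiplication.Theorems.SubgroupIdentityDesigns.Negative

variable {p : ℕ} [Fact p.Prime]

section Ghost

/-- The upper-triangular point `b(x,z,y) = [[x, y], [0, z]]` of `M₂(𝔽_p)`. -/
def bPt (x z y : ZMod p) : CMat p 2 := !![x, y; 0, z]

/-- `tr(M · b(x,z,y)) = M₀₀ x + M₁₁ z + M₁₀ y`. -/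
theorem trace_mul_bPt (M : CMat p 2) (x z y : ZMod p) :
    Matrix.trace (M * bPt x z y) = M 0 0 * x + M 1 1 * z + M 1 0 * y := by
  simp [bPt, Matrix.trace, Matrix.mul_apply, Fin.sum_univ_two]
  ring

/-- `b(x,z,y) = 1` iff `x = 1`, `z = 1`, `y = 0`. -/
theorem bPt_eq_one_iff (x z y : ZMod p) : bPt x z y = 1 ↔ x = 1 ∧ z = 1 ∧ y = 0 := by
  constructor
  · intro h
    have h00 := congrFun (congrFun h 0) 0
    have h01 := congrFun (congrFun h 0) 1
    have h11 := congrFun (congrFun h 1) 1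
    simp [bPt, Matrix.one_apply_ne (show (0 : Fin 2) ≠ 1 by decide)] at h00 h01 h11
    exact ⟨h00, h11, h01⟩
  · rintro ⟨rfl, rfl, rfl⟩
    ext i j
    fin_cases i <;> fin_cases j <;> simp [bPt]

/-- **Coset sum of a Fourier mode**: `Σ_y ψ(tr(M b(x,z,y))) = p·[M₁₀ = 0]·ψ(M₀₀ x + M₁₁ z)`. -/
theorem sum_psi_bPt (M : CMat p 2) (x z : ZMod p) :
    ∑ y : ZMod p, ZMod.stdAddChar (Matrix.trace (M * bPt x z y)) =
      if M 1 0 = 0 then (p : ℂ) * ZMod.stdAddChar (M 0 0 * x + M 1 1 * z) else 0 := by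
  simp_rw [trace_mul_bPt, AddChar.map_add_eq_mul]
  rw [← Finset.mul_sum, sum_psi_mul]
  split_ifs <;> ring

/-- A matrix of rank `≤ 1` in `M₂` is singular: `M₀₀ M₁₁ = M₀₁ M₁₀`. [folklore] -/
theorem entries_of_rank_le_one (M : CMat p 2) (hM : M.rank ≤ 1) : M 0 0 * M 1 1 = M 0 1 * M 1 0 := by
  by_contra hne
  have hdet : M.det ≠ 0 := by
    rw [Matrix.det_fin_two]
    exact sub_ne_zero.mpr hne
  have hunit : IsUnit M := (Matrix.isUnit_iff_isUnit_det _).2 (isUnit_iff_ne_zero.2 hdet)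
  have h2 : M.rank = 2 := by rw [Matrix.rank_of_isUnit _ hunit, Fintype.card_fin]
  omega

/-- **Ghosts annihilate level-one modes.**  If `λ` has zero row and column sums then
`Σ_{x,z} λ(x,z) Σ_y ψ(tr(M b(x,z,y))) = 0` for every `M` of rank `≤ 1`. -/
theorem ghost_mode_eq_zero (w : ZMod p → ZMod p → ℂ) (hrow : ∀ x, ∑ z, w x z = 0)
    (hcol : ∀ z, ∑ x, w x z = 0) (M : CMat p 2) (hM : M.rank ≤ 1) :
    ∑ x, ∑ z, w x z * ∑ y, ZMod.stdAddChar (Matrix.trace (M * bPt x z y)) = 0 := by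
  by_cases h10 : M 1 0 = 0
  · simp_rw [sum_psi_bPt, if_pos h10]
    have hdet := entries_of_rank_le_one M hM
    rw [h10, mul_zero] at hdet
    rcases mul_eq_zero.mp hdet with h00 | h11
    · simp_rw [h00, zero_mul, zero_add]
      rw [Finset.sum_comm]
      refine Finset.sum_eq_zero fun z _ => ?_
      rw [← Finset.sum_mul, hcol z, zero_mul]
    · simp_rw [h11, zero_mul, add_zero]
      refine Finset.sum_eq_zero fun x _ => ?_
      rw [← Finset.sum_mul, hrow x, zero_mul]
  · simp_rw [sum_psi_bPt, if_neg h10, mul_zero, Finset.sum_const_zero]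

/-- The ghost functional of a Fourier function is the `c`-combination of the mode functionals. -/
theorem ghost_fourierMat (w : ZMod p → ZMod p → ℂ) (c : CMat p 2 → ℂ) :
    ∑ x, ∑ z, w x z * ∑ y, fourierMat c (bPt x z y) =
      ∑ M, c M * ∑ x, ∑ z, w x z * ∑ y, ZMod.stdAddChar (Matrix.trace (M * bPt x z y)) := by
  simp only [fourierMat, Finset.mul_sum]
  calc ∑ x, ∑ z, ∑ y, ∑ M, w x z * (c M * ZMod.stdAddChar (Matrix.trace (M * bPt x z y)))
      = ∑ x, ∑ z, ∑ M, ∑ y, w x z * (c M * ZMod.stdAddChar (Matrix.trace (M * bPt x z y))) :=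
        Finset.sum_congr rfl fun x _ => Finset.sum_congr rfl fun z _ => Finset.sum_comm
    _ = ∑ x, ∑ M, ∑ z, ∑ y, w x z * (c M * ZMod.stdAddChar (Matrix.trace (M * bPt x z y))) :=
        Finset.sum_congr rfl fun x _ => Finset.sum_comm
    _ = ∑ M, ∑ x, ∑ z, ∑ y, w x z * (c M * ZMod.stdAddChar (Matrix.trace (M * bPt x z y))) :=
        Finset.sum_comm
    _ = _ := Finset.sum_congr rfl fun M _ => Finset.sum_congr rfl fun x _ =>
        Finset.sum_congr rfl fun z _ => Finset.sum_congr rfl fun y _ => by ring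

/-- **GHOST SUMS VANISH ON LEVEL ONE.**  For a rank-`≤ 1`-supported table `c` and a weight `λ`
with zero row and column sums, `Σ_{x,z} λ(x,z) Σ_y f_c(b(x,z,y)) = 0`. -/
theorem ghost_sum_eq_zero (w : ZMod p → ZMod p → ℂ) (hrow : ∀ x, ∑ z, w x z = 0)
    (hcol : ∀ z, ∑ x, w x z = 0) (c : CMat p 2 → ℂ) (hc : ∀ M : CMat p 2, 1 < M.rank → c M = 0) :
    ∑ x, ∑ z, w x z * ∑ y, fourierMat c (bPt x z y) = 0 := by
  rw [ghost_fourierMat]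
  refine Finset.sum_eq_zero fun M _ => ?_
  by_cases hM : M.rank ≤ 1
  · rw [ghost_mode_eq_zero w hrow hcol M hM, mul_zero]
  · rw [hc M (by omega), zero_mul]

/-- **NO LEVEL-ONE IDENTITY TEST IN THE PRESENCE OF A GHOST.**  Let `S ⊆ M₂(𝔽_p)` and let
`λ : 𝔽_p × 𝔽_p → ℂ` be supported on pairs `(x,z)` whose full unipotent coset `{b(x,z,y) : y}` lies in
`S`, with all row sums and column sums zero and `λ(1,1) ≠ 0`.  Then no rank-`≤ 1`-supported `c` has
`f_c(1) = 1` and `f_c = 0` on `S ∖ {1}`.  (A cycle of the coset graph through `(1,1)` with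
alternating weights `±1` is such a ghost: Theorem H, FAIL direction.) -/
theorem no_idTest_of_ghost (S : Set (CMat p 2)) (w : ZMod p → ZMod p → ℂ)
    (hsupp : ∀ x z, w x z ≠ 0 → ∀ y, bPt x z y ∈ S)
    (hrow : ∀ x, ∑ z, w x z = 0) (hcol : ∀ z, ∑ x, w x z = 0) (h11 : w 1 1 ≠ 0)
    (c : CMat p 2 → ℂ) (hc : ∀ M : CMat p 2, 1 < M.rank → c M = 0)
    (h1 : fourierMat c 1 = 1) (h0 : ∀ s ∈ S, s ≠ 1 → fourierMat c s = 0) : False := by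
  have hval : ∀ x z y, w x z * fourierMat c (bPt x z y) =
      if x = 1 ∧ z = 1 ∧ y = 0 then w 1 1 else 0 := by
    intro x z y
    split_ifs with h
    · obtain ⟨rfl, rfl, rfl⟩ := h
      rw [(bPt_eq_one_iff 1 1 0).2 ⟨rfl, rfl, rfl⟩, h1, mul_one]
    · by_cases hw : w x z = 0
      · rw [hw, zero_mul]
      · rw [h0 _ (hsupp x z hw y) (fun h1' => h ((bPt_eq_one_iff x z y).1 h1')), mul_zero]
  have hsum := ghost_sum_eq_zero w hrow hcol c hc
  simp_rw [Finset.mul_sum, hval] at hsum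
  rw [Fintype.sum_eq_single 1 (fun x hx => by simp [hx]),
    Fintype.sum_eq_single 1 (fun z hz => by simp [hz]),
    Fintype.sum_eq_single 0 (fun y hy => by simp [hy])] at hsum
  simp only [and_self, if_true] at hsum
  exact h11 hsum

/-- **The crux-language form.**  If the triple products `a b g` (`a ∈ H₁, b ∈ H₂, g ∈ H₃`) of three
subgroups of `GL₂(𝔽_p)` contain every point of the full unipotent cosets carrying a ghost `λ`
(zero row/column sums, `λ(1,1) ≠ 0`), then the identity-design clause of `SubgroupIdentityDesigns`
fails at `m = 2`, `k = 1` for `(H₁, H₂, H₃)`. -/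
theorem no_levelOne_design_of_ghost {H₁ H₂ H₃ : Subgroup (GLm p 2)} (w : ZMod p → ZMod p → ℂ)
    (hsupp : ∀ x z, w x z ≠ 0 → ∀ y, ∃ a ∈ H₁, ∃ b ∈ H₂, ∃ g ∈ H₃,
      ((a * b * g : GLm p 2) : Mat p 2) = !![x, y; 0, z])
    (hrow : ∀ x, ∑ z, w x z = 0) (hcol : ∀ z, ∑ x, w x z = 0) (h11 : w 1 1 ≠ 0) :
    ¬ ∃ c : Matrix (Fin 2) (Fin 2) (ZMod p) → ℂ, (∀ M, 1 < M.rank → c M = 0) ∧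
      (∑ M, c M * ZMod.stdAddChar (Matrix.trace (M * ((1 : GLm p 2) : Mat p 2)))) = 1 ∧
      ∀ a ∈ H₁, ∀ b ∈ H₂, ∀ g ∈ H₃, a * b * g ≠ 1 →
        (∑ M, c M * ZMod.stdAddChar
          (Matrix.trace (M * ((a * b * g : GLm p 2) : Mat p 2)))) = 0 := by
  rintro ⟨c, hc, h1, h0⟩
  set S : Set (CMat p 2) :=
    {s | ∃ a ∈ H₁, ∃ b ∈ H₂, ∃ g ∈ H₃, s = ((a * b * g : GLm p 2) : Mat p 2)} with hS_def
  have hS : ∀ x z, w x z ≠ 0 → ∀ y, bPt x z y ∈ S := by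
    intro x z hw y
    obtain ⟨a, ha, b, hb, g, hg, hs⟩ := hsupp x z hw y
    exact ⟨a, ha, b, hb, g, hg, by rw [hs]; rfl⟩
  have h1' : fourierMat c 1 = 1 := by simpa [fourierMat] using h1
  have h0' : ∀ s ∈ S, s ≠ 1 → fourierMat c s = 0 := by
    rintro s ⟨a, ha, b, hb, g, hg, rfl⟩ hs1
    have hne : a * b * g ≠ 1 := fun h => hs1 (by rw [h, Units.val_one])
    simpa [fourierMat] using h0 a ha b hb g hg hne
  exact no_idTest_of_ghost S w hS hrow hcol h11 c hc h1' h0'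

/-- **Cycles are ghosts (the 4-cycle).**  The alternating weight on a coset square
`(1,1), (a,1), (a,b), (1,b)` (`a, b ≠ 1`) has zero row and column sums and weight `1` at `(1,1)`;
with `no_idTest_of_ghost` this re-proves the `k = 1` torus square of `no_idTest_of_torusCube`. -/
theorem squareGhost_rows (a b : ZMod p) (ha : a ≠ 1) (hb : b ≠ 1) :
    let w : ZMod p → ZMod p → ℂ := fun x z =>
      (if x = 1 then (1 : ℂ) else 0) * (if z = 1 then 1 else 0) - (if x = a then 1 else 0) *
        (if z = 1 then 1 else 0) - (if x = 1 then 1 else 0) * (if z = b then 1 else 0) +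
        (if x = a then 1 else 0) * (if z = b then 1 else 0)
    (∀ x, ∑ z, w x z = 0) ∧ (∀ z, ∑ x, w x z = 0) ∧ w 1 1 = 1 := by
  refine ⟨fun x => ?_, fun z => ?_, ?_⟩
  · simp only [Finset.sum_add_distrib, Finset.sum_sub_distrib, ← Finset.mul_sum,
      Finset.sum_ite_eq', Finset.mem_univ, if_true]
    ring
  · simp only [Finset.sum_add_distrib, Finset.sum_sub_distrib, ← Finset.sum_mul,
      Finset.sum_ite_eq', Finset.mem_univ, if_true]
    ring
  · simp [Ne.symm ha, Ne.symm hb]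

end Ghost

end Summit.MatrixMultiplication.MatrixMultiplication.Theorems.SubgroupIdentityDesigns.Negative

end
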